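import Summits.CriticalPhenomena.SAWScalingLimit.Theorems.SAWTotalPositivityCriticalBubbleBoundKestenMSReflect
import Summits.CriticalPhenomena.SAWScalingLimit.Theorems.SAWTotalPositivityCriticalBubbleBoundKestenMSSignAveraging
import Summits.CriticalPhenomena.SAWScalingLimit.Theorems.SAWTotalPositivityCriticalBubbleBoundKestenMSBinomialMoment
import Summits.CriticalPhenomena.SAWScalingLimit.Theorems.SAWTotalPositivityCriticalBubbleBoundKestenMSLittlewoodOfford
import Summits.CriticalPhenomena.SAWScalingLimit.Theorems.SAWTotalPositivityCriticalBubbleBoundKestenMSFactorisation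
import Summits.CriticalPhenomena.SAWScalingLimit.Theorems.SAWTotalPositivityCriticalBubbleBoundKestenHWFloor
import HarnessLib

/-!
# Madras–Slade Proposition 8.1.4 for `ℤ²` in the word model (line `kesten-product-renewal-dictionary`,
crux `SAWTotalPositivity.CriticalBubbleBound`, stmt-CriticalPhenomena-7117; lead c5, stub H `ms_pinnedBridgeMass_antitone`)

For every non-increasing `h : ℕ → [0,∞]` and every transversal level `y ∈ ℤ`,

  `Σ_{w self-avoiding bridge word, wEnd w 1 = y} h(|w|) x_c^{|w|} ≤ (√2 / x_c) · Σ_m h(m) (m+1)^{-1/2}`.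

This is (8.1.27) of N. Madras, G. Slade, *The Self-Avoiding Walk* (1993), Proposition 8.1.4, for `d = 2`,
with an explicit constant. Proof (the book's, with Lemma 8.1.3 replaced by the Fourier-free
anti-concentration bound landed in this programme):

* Kesten's FULL factorisation (`MS.ms_irrFactorisation`): the concatenation map from `Σ_m Irr^m` (tuples of
  irreducible bridges) to self-avoiding bridge words is a bijection; it adds lengths and endpoints. Hence the
  left-hand side is `Σ_m Σ_{s ∈ Irr^m, Σ_k yEnd(s_k) = y} h(Σ_k |s_k|) Π_k x_c^{|s_k|}`
  (`Function.Injective.tsum_eq`, `ENNReal.tsum_sigma'`).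
* `Σ_k |s_k| ≥ m` (irreducible bridges are non-empty) and `h` is non-increasing, so the inner sum is at most
  `h(m) · G_m(y)`, `G_m(y) := Σ_{s ∈ Irr^m, Σ q = y} Π μ`, `μ(s) = x_c^{|s|}`, `q(s) = wEnd s 1` — (8.1.18):
  "at least `m` steps are needed for `m` renewals".
* ANTI-CONCENTRATION `G_m(y) ≤ √2 (x_c² (m+1))^{-1/2}`: sign-averaging over the reflection `y ↦ -y` of the
  factors (`MS.ms_signAveraging` with the involution of `MS.ms_irrBridge_reflect` and the Littlewood–Offord count
  `MS.ms_littlewoodOfford`), then the binomial moment bound `MS.ms_binomialMoment` with total mass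
  `Σ_irr x_c^{|s|} = 1` (Kesten's identity `HW.kestenIdentity`) and non-degeneracy mass `p = x_c²` (the
  irreducible bridge `EN` has transversal displacement `1`).

Sources: Madras–Slade 1993, §8.1 (Prop. 8.1.4, Lemma 8.1.3, (8.1.14)–(8.1.18)); N. Madras, *Bounds on the
critical exponent of self-avoiding polygons*, in: Random walks, Brownian motion and interacting particle
systems, Progr. Probab. 28 (1991); H. Kesten, J. Math. Phys. 4 (1963), §4; P. Erdős, Bull. AMS 51 (1945)
(Littlewood–Offord).
-/

noncomputable section

open Literature.Probability.LatticeModels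
open Literature.Probability.RandomPlanarGeometry Literature.Probability.RandomPlanarGeometry.SAW
open scoped ENNReal NNReal BigOperators
open Classical

namespace Summit.CriticalPhenomena.SAWScalingLimit.Theorems.CriticalBubbleBound.Kesten.MS

/-! ## Bookkeeping for concatenations of tuples of words -/

/-- The endpoint of a concatenation is the sum of the endpoints. [folklore] -/
theorem ms814_wEnd_flatten (L : List (List Step)) : wEnd L.flatten = (L.map wEnd).sum := by
  induction L with
  | nil => simp
  | cons a L ih => simp [ih]

/-- The endpoint of the concatenation of a tuple of words is the sum of their endpoints. [folklore] -/
theorem ms814_wEnd_flatten_ofFn {m : ℕ} (f : Fin m → List Step) :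
    wEnd (List.ofFn f).flatten = ∑ k, wEnd (f k) := by
  rw [ms814_wEnd_flatten, List.map_ofFn, List.sum_ofFn]
  rfl

/-- The length of the concatenation of a tuple of words is the sum of their lengths. [folklore] -/
theorem ms814_length_flatten_ofFn {m : ℕ} (f : Fin m → List Step) :
    (List.ofFn f).flatten.length = ∑ k, (f k).length := by
  rw [List.length_flatten, List.map_ofFn, List.sum_ofFn]
  rfl

/-- A concatenation of `m` irreducible bridges has at least `m` letters. [folklore] -/
theorem ms814_le_length_flatten {m : ℕ} (s : Fin m → {w : List Step // IsIrrBridge w}) :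
    m ≤ (List.ofFn (fun k => (s k).1)).flatten.length := by
  rw [ms814_length_flatten_ofFn]
  calc m = ∑ _k : Fin m, 1 := by simp
    _ ≤ ∑ k, ((s k).1).length :=
        Finset.sum_le_sum fun k _ => List.length_pos_iff.2 (s k).2.ne_nil

/-- The critical weight of a concatenation is the product of the weights. [folklore] -/
theorem ms814_ofReal_pow_flatten {m : ℕ} (s : Fin m → {w : List Step // IsIrrBridge w}) :
    ENNReal.ofReal (criticalFugacity ^ (List.ofFn (fun k => (s k).1)).flatten.length) =
      ∏ k, ENNReal.ofReal (criticalFugacity ^ ((s k).1).length) := by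
  rw [ms814_length_flatten_ofFn, ← Finset.prod_pow_eq_pow_sum,
    ENNReal.ofReal_prod_of_nonneg (fun k _ => pow_nonneg StripMass.criticalFugacity_pos.le _)]

/-! ## The irreducible-bridge weight is a sub-probability with symmetric, non-degenerate transversal step -/

/-- Kesten's identity in `ℝ≥0∞`: `Σ_{s irreducible} x_c^{|s|} = 1`. [cite: MadrasSlade1993, §4.2, eq. (4.2.4)] -/
theorem ms814_tsum_irr_mass_eq_one :
    (∑' s : {w : List Step // IsIrrBridge w}, ENNReal.ofReal (criticalFugacity ^ s.1.length)) = 1 := by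
  rw [← ENNReal.ofReal_tsum_of_nonneg (fun s => pow_nonneg StripMass.criticalFugacity_pos.le _)
    HW.kestenIdentity.summable, HW.tsum_irrBridge_criticalFugacity_pow, ENNReal.ofReal_one]

/-- Non-degeneracy of the transversal step: the irreducible bridges with non-zero transversal displacement
carry mass at least `x_c²` (the word `EN`). [cite: MadrasSlade1993, Lemma 8.1.8] -/
theorem ms814_mass_ne_zero_ge :
    ENNReal.ofReal (criticalFugacity ^ 2) ≤
      ∑' s : {w : List Step // IsIrrBridge w},
        if wEnd s.1 1 ≠ 0 then ENNReal.ofReal (criticalFugacity ^ s.1.length) else 0 := by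
  obtain ⟨-, hEN, hwEnd⟩ := ms_irrBridge_reflect
  let s₀ : {w : List Step // IsIrrBridge w} := ⟨[0, 1], hEN⟩
  calc ENNReal.ofReal (criticalFugacity ^ 2)
      = (if wEnd s₀.1 1 ≠ 0 then ENNReal.ofReal (criticalFugacity ^ s₀.1.length) else 0) := by
        have h1 : wEnd s₀.1 1 ≠ 0 := by rw [hwEnd]; exact one_ne_zero
        rw [if_pos h1]
        rfl
    _ ≤ _ := ENNReal.le_tsum s₀

/-- ANTI-CONCENTRATION of the transversal coordinate of Kesten's renewal walk (MS Lemma 8.1.3 for `d = 2`,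
Fourier-free): the critical mass of `m`-tuples of irreducible bridges with total transversal displacement `y`
is at most `√2 · (x_c² (m+1))^{-1/2}`, uniformly in `y`. [cite: MadrasSlade1993, Lemma 8.1.3] -/
theorem ms814_anticoncentration (m : ℕ) (y : ℤ) :
    (∑' s : Fin m → {w : List Step // IsIrrBridge w},
        if (∑ k, wEnd (s k).1 1) = y then ∏ k, ENNReal.ofReal (criticalFugacity ^ ((s k).1).length) else 0) ≤
      ENNReal.ofReal (Real.sqrt 2) * ENNReal.ofReal (1 / Real.sqrt (criticalFugacity ^ 2 * (m + 1))) := by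
  obtain ⟨⟨r, hr, hrw⟩, -, -⟩ := ms_irrBridge_reflect
  -- the reflection as an involution of the irreducible bridges
  let ρ : {w : List Step // IsIrrBridge w} → {w : List Step // IsIrrBridge w} :=
    fun s => ⟨r s.1, (hrw s.1).1 s.2⟩
  have hρ : Function.Involutive ρ := fun s => Subtype.ext (hr s.1)
  let μ : {w : List Step // IsIrrBridge w} → ℝ≥0∞ := fun s => ENNReal.ofReal (criticalFugacity ^ s.1.length)
  let q : {w : List Step // IsIrrBridge w} → ℤ := fun s => wEnd s.1 1
  have hμ : ∀ s, μ (ρ s) = μ s := fun s => by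
    show ENNReal.ofReal (criticalFugacity ^ (r s.1).length) = _
    rw [(hrw s.1).2.1]
  have hq : ∀ s, q (ρ s) = -q s := fun s => (hrw s.1).2.2.1
  have h1 := ms_signAveraging μ ρ q hρ hμ hq ms_littlewoodOfford m y
  have h2 := ms_binomialMoment μ q (criticalFugacity ^ 2) (pow_pos StripMass.criticalFugacity_pos 2)
    (le_of_eq ms814_tsum_irr_mass_eq_one) ms814_mass_ne_zero_ge m
  exact h1.trans (mul_le_mul' le_rfl h2)

/-- The constant: `√2 · (x_c²(m+1))^{-1/2} = (√2/x_c) · (m+1)^{-1/2}`. [folklore] -/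
theorem ms814_const (m : ℕ) :
    ENNReal.ofReal (Real.sqrt 2) * ENNReal.ofReal (1 / Real.sqrt (criticalFugacity ^ 2 * (m + 1))) =
      ENNReal.ofReal (Real.sqrt 2 / criticalFugacity) * ENNReal.ofReal (1 / Real.sqrt ((m : ℝ) + 1)) := by
  have hx := StripMass.criticalFugacity_pos
  rw [← ENNReal.ofReal_mul (Real.sqrt_nonneg 2), ← ENNReal.ofReal_mul (by positivity)]
  congr 1
  rw [Real.sqrt_mul (sq_nonneg _), Real.sqrt_sq hx.le]
  field_simp

/-! ## Proposition 8.1.4 -/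

/-- **MS Proposition 8.1.4 for `ℤ²`** (stub H `ms_pinnedBridgeMass_antitone` of the c5 programme of the line
`kesten-product-renewal-dictionary`): for every non-increasing `h : ℕ → [0,∞]` and every transversal level `y`,
`Σ_{w self-avoiding bridge word, wEnd w 1 = y} h(|w|) x_c^{|w|} ≤ (√2 / x_c) · Σ_m h(m) (m+1)^{-1/2}`.
[cite: MadrasSlade1993, Proposition 8.1.4] -/
theorem ms_pinnedBridgeMass_antitone : ∀ (h : ℕ → ℝ≥0∞), Antitone h → ∀ y : ℤ, (∑' w : {w : List Step // IsSAW w ∧ IsBridgeW w ∧ wEnd w 1 = y}, h w.1.length * ENNReal.ofReal (criticalFugacity ^ w.1.length)) ≤ ENNReal.ofReal (Real.sqrt 2 / criticalFugacity) * ∑' m : ℕ, h m * ENNReal.ofReal (1 / Real.sqrt ((m : ℝ) + 1)) := by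
  intro h hh y
  obtain ⟨hG1, hG2, hG3⟩ := ms_irrFactorisation
  -- the summand, extended by zero to all words
  let F : List Step → ℝ≥0∞ := fun w => h w.length * ENNReal.ofReal (criticalFugacity ^ w.length)
  let f : List Step → ℝ≥0∞ := fun w => if IsSAW w ∧ IsBridgeW w ∧ wEnd w 1 = y then F w else 0
  let Φ : (Σ m : ℕ, (Fin m → {w : List Step // IsIrrBridge w})) → List Step :=
    fun x => (List.ofFn (fun k => (x.2 k).1)).flatten
  -- Step 1: the subtype sum is the sum of `f` over all words
  have step1 : (∑' w : {w : List Step // IsSAW w ∧ IsBridgeW w ∧ wEnd w 1 = y}, F w.1) = ∑' w, f w := by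
    have e1 : (∑' w : {w : List Step // IsSAW w ∧ IsBridgeW w ∧ wEnd w 1 = y}, F w.1) =
        ∑' w, ({w | IsSAW w ∧ IsBridgeW w ∧ wEnd w 1 = y} : Set (List Step)).indicator F w :=
      tsum_subtype ({w | IsSAW w ∧ IsBridgeW w ∧ wEnd w 1 = y} : Set (List Step)) F
    rw [e1]
    refine tsum_congr fun w => ?_
    by_cases hc : IsSAW w ∧ IsBridgeW w ∧ wEnd w 1 = y
    · rw [Set.indicator_of_mem (show w ∈ {w | IsSAW w ∧ IsBridgeW w ∧ wEnd w 1 = y} from hc)]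
      exact (if_pos hc).symm
    · rw [Set.indicator_of_notMem (show w ∉ {w | IsSAW w ∧ IsBridgeW w ∧ wEnd w 1 = y} from hc)]
      exact (if_neg hc).symm
  -- Step 2: reindex by Kesten's factorisation
  have hsupp : Function.support f ⊆ Set.range Φ := by
    intro w hw
    rw [Function.mem_support] at hw
    by_cases hc : IsSAW w ∧ IsBridgeW w ∧ wEnd w 1 = y
    · obtain ⟨x, hx⟩ := hG3 w hc.1 hc.2.1
      exact ⟨x, hx⟩
    · exact absurd (if_neg hc) hw
  have step2 : (∑' w, f w) = ∑' m : ℕ, ∑' s : Fin m → {w : List Step // IsIrrBridge w}, f (Φ ⟨m, s⟩) := by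
    rw [← hG2.tsum_eq hsupp, ENNReal.tsum_sigma']
  -- Step 3: termwise bound at `m` renewals
  have step3 : ∀ (m : ℕ) (s : Fin m → {w : List Step // IsIrrBridge w}), f (Φ ⟨m, s⟩) ≤
      h m * (if (∑ k, wEnd (s k).1 1) = y then ∏ k, ENNReal.ofReal (criticalFugacity ^ ((s k).1).length)
        else 0) := by
    intro m s
    by_cases hc : IsSAW (Φ ⟨m, s⟩) ∧ IsBridgeW (Φ ⟨m, s⟩) ∧ wEnd (Φ ⟨m, s⟩) 1 = y
    · have hy : (∑ k, wEnd (s k).1 1) = y := by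
        have := hc.2.2
        rw [show Φ ⟨m, s⟩ = (List.ofFn (fun k => (s k).1)).flatten from rfl,
          ms814_wEnd_flatten_ofFn, Finset.sum_apply] at this
        exact this
      show (if _ then F (Φ ⟨m, s⟩) else 0) ≤ _
      rw [if_pos hc, if_pos hy]
      show h ((List.ofFn (fun k => (s k).1)).flatten.length) *
          ENNReal.ofReal (criticalFugacity ^ (List.ofFn (fun k => (s k).1)).flatten.length) ≤ _
      rw [ms814_ofReal_pow_flatten]
      exact mul_le_mul' (hh (ms814_le_length_flatten s)) le_rfl
    · show (if _ then F (Φ ⟨m, s⟩) else 0) ≤ _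
      rw [if_neg hc]
      exact zero_le
  -- Step 4: sum over `s`, anti-concentration, constant
  have step4 : ∀ m : ℕ, (∑' s : Fin m → {w : List Step // IsIrrBridge w}, f (Φ ⟨m, s⟩)) ≤
      ENNReal.ofReal (Real.sqrt 2 / criticalFugacity) * (h m * ENNReal.ofReal (1 / Real.sqrt ((m : ℝ) + 1))) := by
    intro m
    calc (∑' s : Fin m → {w : List Step // IsIrrBridge w}, f (Φ ⟨m, s⟩))
        ≤ ∑' s : Fin m → {w : List Step // IsIrrBridge w}, h m *
            (if (∑ k, wEnd (s k).1 1) = y then ∏ k, ENNReal.ofReal (criticalFugacity ^ ((s k).1).length)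
              else 0) := ENNReal.tsum_le_tsum (step3 m)
      _ = h m * ∑' s : Fin m → {w : List Step // IsIrrBridge w},
            (if (∑ k, wEnd (s k).1 1) = y then ∏ k, ENNReal.ofReal (criticalFugacity ^ ((s k).1).length)
              else 0) := ENNReal.tsum_mul_left
      _ ≤ h m * (ENNReal.ofReal (Real.sqrt 2) *
            ENNReal.ofReal (1 / Real.sqrt (criticalFugacity ^ 2 * (m + 1)))) :=
          mul_le_mul' le_rfl (ms814_anticoncentration m y)
      _ = ENNReal.ofReal (Real.sqrt 2 / criticalFugacity) *
            (h m * ENNReal.ofReal (1 / Real.sqrt ((m : ℝ) + 1))) := by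
          rw [ms814_const]; ring
  -- assemble
  calc (∑' w : {w : List Step // IsSAW w ∧ IsBridgeW w ∧ wEnd w 1 = y}, F w.1)
      = ∑' m : ℕ, ∑' s : Fin m → {w : List Step // IsIrrBridge w}, f (Φ ⟨m, s⟩) := step1.trans step2
    _ ≤ ∑' m : ℕ, ENNReal.ofReal (Real.sqrt 2 / criticalFugacity) *
          (h m * ENNReal.ofReal (1 / Real.sqrt ((m : ℝ) + 1))) := ENNReal.tsum_le_tsum step4
    _ = _ := ENNReal.tsum_mul_left

end Summit.CriticalPhenomena.SAWScalingLimit.Theorems.CriticalBubbleBound.Kesten.MS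

end
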